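import Literature.NumberTheory.Sieve.QuadraticRootsPrimeModuliDFI
import Literature.NumberTheory.Sieve.PolynomialCongruencesProofs
import Literature.NumberTheory.Sieve.GoldbachSingularSeriesSum
import HarnessLib

/-!
# Duke–Friedlander–Iwaniec 1995, §7 (i): objects of the assembly and the reduction to (34)–(35)

Topic `Literature/NumberTheory/Sieve`, companion of `QuadraticRootsPrimeModuliDFI.lean` (the
printed Propositions 1, 2, 4 and Theorem 5 of W. Duke, J. B. Friedlander, H. Iwaniec,
*Equidistribution of roots of a quadratic congruence to prime moduli*, Ann. of Math. 141 (1995)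
423–441, as named facts).  §7 of the paper reads, in full: "Theorem 5 is applicable for the
sequence `c_n = ρ_h(n)`, `1 ≤ n ≤ x`.  The hypothesis (34) follows from Proposition 1 and (35)
follows from Proposition 2.  Therefore we have `∑_{p ≤ x} ρ_h(p) ≪ ε π(x)`.  By taking `ε`
arbitrarily small we conclude the proof of (6)."  The Lean proof of that paragraph occupies this
file and its three successors (`…DFILinear`, `…DFIBilinearBlocks`/`…DFIBilinear`,
`…DFIAssembly`); this file holds the objects and the outer reduction:

* `DFI1995.Hyp34 f h ε`, `DFI1995.Hyp35 f h ε` — hypotheses (34) (level `D = x^{1/2−ε}`) and (35)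
  (`y = x^{1/3−ε}`, `w = x^{(log log x)^{−3}}`) of Theorem 5 for the sequence `c_n = ρ_h(n)`
  (`DFI1995.rhoSeq`), as predicates;
* `DFI1995.isLittleO_sum_primesLE_of_theorem5` — **Theorem 5 + (34) + (35) for `ρ_h` (all
  `0 < ε ≤ 1/12`) ⇒ `∑_{p ≤ P} ρ_h(p) = o(π(P))`** (`f = aX² + 2bX + c`, `ac > b²`, `h ≥ 1`);
* `exists_norm_polyRootWeylSum_quad_le`: **`|ρ_h(n)| ≤ ρ(n) ≤ C_f τ(n)`** — Theorem 5 wants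
  `|c_n| ≤ τ(n)`, which fails for `ρ_h` itself (`f = X² + 64`: `ρ(64) = 8 > τ(64) = 7`), so it is
  applied to `ρ_h / C_f` (everything is linear: `DFI1995.sieveR₁_const_mul`,
  `DFI1995.sieveR₂_const_mul`).  Proof: the primitive part `f₀` of `f` is an irreducible quadratic
  (no rational root as `ac > b²`; Gauss's lemma), Hooley's Lemma 4 `ρ_{f₀}(k) ≤ C 2^{ω(k)}`
  (`exists_polyRootCountMod_le_mul_pow_card_primeFactors`, `PolynomialCongruencesProofs.lean`),
  a root of `f = g f₀` modulo `n` is a root of `f₀` modulo `n₁ = n/(n, g)` (an `n₁`-periodic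
  condition with `(n, g) ρ_{f₀}(n₁)` solutions modulo `n`), and `2^{ω(n)} ≤ τ(n)`
  (`GoldbachSeries.two_pow_card_primeFactors_le_card_divisors`);
* `polyRootWeylSum_neg`: `ρ_{−h} = conj ∘ ρ_h` ("it clearly suffices to prove (6) for `h > 0`",
  p. 424);
* the objects of the two inner deductions: partial sums `S_d(t) = ∑_{m ≤ t} ρ_h(dm)`
  (`DFI1995.partialSum`) with `L_d(M) = S_d(2M) − S_d(M)` and the dyadic decomposition, and the
  fibre sums `T_S(t) = ∑_{n ∈ S} β_n ∑_{m ≤ t, (m,n)=1} α_m ρ_h(mn)` (`DFI1995.fiberSum`) whose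
  dyadic blocks are the bilinear forms `B(M, N')(α|_{(M,2M]}, β|_S)` of Proposition 2
  (`DFI1995.fiberSum_two_mul_sub`, coefficients `DFI1995.blockAlpha`, `DFI1995.fiberBeta`).

Everything in this file is proved.

## References

* W. Duke, J. B. Friedlander, H. Iwaniec, Ann. of Math. (2) 141 (1995), 423–441, §7 p. 438,
  (4) p. 424, (8) p. 425, (32)–(35) pp. 436–437. [cite: DukeFriedlanderIwaniec1995, §7]
-/

namespace Literature.NumberTheory.Sieve

open scoped BigOperators Polynomial
open Filter Asymptotics Finset Polynomial

/-! ### Elementary facts about `ρ_h` -/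

/-- `ρ_{−h}(d) = conj ρ_h(d)`. [folklore] -/
theorem polyRootWeylSum_neg (f : ℤ[X]) (d : ℕ) (h : ℤ) :
    polyRootWeylSum f d (-h) = (starRingEnd ℂ) (polyRootWeylSum f d h) := by
  unfold polyRootWeylSum
  rw [map_sum]
  refine Finset.sum_congr rfl fun ν _ => ?_
  rw [← Complex.exp_conj]
  congr 1
  simp only [map_mul, map_div₀, Complex.conj_ofReal, Complex.conj_I, map_ofNat, map_intCast,
    map_natCast]
  push_cast
  ring

namespace DFI1995

/-- `R(D)` is linear in the sequence (scaling). [folklore] -/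
theorem sieveR₁_const_mul (r : ℂ) (c lam : ℕ → ℂ) (x D : ℝ) :
    sieveR₁ (fun n => r * c n) lam x D = r * sieveR₁ c lam x D := by
  simp only [sieveR₁, Finset.mul_sum]
  exact Finset.sum_congr rfl fun d _ => Finset.sum_congr rfl fun m _ => by ring

/-- `R(w, y)` is linear in the sequence (scaling). [folklore] -/
theorem sieveR₂_const_mul (r : ℂ) (c α β : ℕ → ℂ) (x w y : ℝ) :
    sieveR₂ (fun n => r * c n) α β x w y = r * sieveR₂ c α β x w y := by
  simp only [sieveR₂, Finset.mul_sum]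
  exact Finset.sum_congr rfl fun n _ => Finset.sum_congr rfl fun m _ => by ring

end DFI1995

/-! ### `ρ_f(n) ≪ τ(n)` for DFI's quadratics -/

/-- Counting a periodic predicate over `q` periods. [folklore] -/
theorem count_mul_of_periodic {P : ℕ → Prop} [DecidablePred P] {a : ℕ}
    (hP : Function.Periodic P a) (q : ℕ) : Nat.count P (q * a) = q * Nat.count P a := by
  induction q with
  | zero => simp
  | succ q ih =>
    have hshift : Nat.count (fun k => P (q * a + k)) a = Nat.count P a := by
      rw [Nat.count_eq_card_filter_range, Nat.count_eq_card_filter_range]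
      exact congrArg Finset.card (Finset.filter_congr fun k _ => by
        rw [add_comm]; exact Iff.of_eq ((hP.nat_mul q) k))
    rw [Nat.succ_mul, Nat.count_add, ih, hshift]
    ring

/-- The divisibility `n' ∣ g(ν)` is `n'`-periodic in `ν`. [folklore] -/
theorem periodic_dvd_eval (g : ℤ[X]) (n' : ℕ) :
    Function.Periodic (fun ν : ℕ => (n' : ℤ) ∣ g.eval (ν : ℤ)) n' := by
  intro ν
  apply propext
  have hdvd : (n' : ℤ) ∣ g.eval ((ν : ℤ) + n') - g.eval (ν : ℤ) := by
    have := sub_dvd_eval_sub ((ν : ℤ) + n') (ν : ℤ) g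
    simpa using this
  simp only [Nat.cast_add]
  exact ⟨fun h => (dvd_sub_right h).mp hdvd, fun h => (dvd_sub_left h).mp hdvd⟩

/-- Counting the `n'`-periodic condition `n' ∣ g(ν)` over `0 ≤ ν < q n'`. [folklore] -/
theorem card_filter_range_mul_dvd_eval (g : ℤ[X]) (n' q : ℕ) :
    ((Finset.range (q * n')).filter (fun ν : ℕ => (n' : ℤ) ∣ g.eval (ν : ℤ))).card =
      q * ((Finset.range n').filter (fun ν : ℕ => (n' : ℤ) ∣ g.eval (ν : ℤ))).card := by
  rw [← Nat.count_eq_card_filter_range, ← Nat.count_eq_card_filter_range]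
  exact count_mul_of_periodic (periodic_dvd_eval g n') q

/-- `n ∣ g y` with `g ≠ 0` forces `n / (n, g) ∣ y`. [folklore] -/
theorem div_gcd_dvd_of_dvd_mul {n g : ℕ} (hg : g ≠ 0) {y : ℤ} (h : (n : ℤ) ∣ (g : ℤ) * y) :
    ((n / Nat.gcd n g : ℕ) : ℤ) ∣ y := by
  rcases Nat.eq_zero_or_pos n with rfl | hn
  · simp at h ⊢
    rcases h with h | h
    · exact absurd h (by exact_mod_cast hg)
    · simp [h]
  set d := Nat.gcd n g with hd
  have hd0 : 0 < d := Nat.gcd_pos_of_pos_left _ hn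
  obtain ⟨n₁, hn₁⟩ : d ∣ n := Nat.gcd_dvd_left n g
  obtain ⟨g₁, hg₁⟩ : d ∣ g := Nat.gcd_dvd_right n g
  have hcop : Nat.Coprime n₁ g₁ := by
    have := Nat.coprime_div_gcd_div_gcd (m := n) (n := g) hd0
    rw [← hd] at this
    convert this using 1
    · rw [hn₁, Nat.mul_div_cancel_left _ hd0]
    · rw [hg₁, Nat.mul_div_cancel_left _ hd0]
  have hdiv : n / d = n₁ := by rw [hn₁, Nat.mul_div_cancel_left _ hd0]
  rw [hdiv]
  have h' : (n₁ : ℤ) ∣ (g₁ : ℤ) * y := by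
    rw [hn₁, hg₁] at h
    push_cast at h
    rw [mul_assoc] at h
    exact Int.dvd_of_mul_dvd_mul_left (by exact_mod_cast hd0.ne') h
  exact Int.dvd_of_dvd_mul_right_of_gcd_one h' (by
    rw [Int.gcd_natCast_natCast]; exact hcop)

/-- **`|ρ_h(n)| ≤ ρ(n) ≤ C_f τ(n)`** for `f = aX² + 2bX + c` with `ac − b² > 0`: the primitive
part `f₀` of `f` is an irreducible quadratic (no rational root), `ρ_{f₀}(k) ≤ C 2^{ω(k)}`
(Hooley's Lemma 4, `exists_polyRootCountMod_le_mul_pow_card_primeFactors`), a root of `f` modulo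
`n` is a root of `f₀` modulo `n/(n, cont f)`, and `2^{ω(n)} ≤ τ(n)`. [folklore] -/
theorem exists_norm_polyRootWeylSum_quad_le {a b c : ℤ} (hD : 0 < a * c - b ^ 2) :
    ∃ Cρ : ℝ, 1 ≤ Cρ ∧ ∀ h : ℤ, ∀ n : ℕ, 1 ≤ n →
      ‖polyRootWeylSum (DFI1995.quad a b c) n h‖ ≤ Cρ * (Nat.divisors n).card := by
  have ha : a ≠ 0 := by
    rintro rfl
    nlinarith [sq_nonneg b]
  set F : ℤ[X] := DFI1995.quad a b c with hFdef
  have hFdeg : F.natDegree = 2 := by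
    rw [hFdef, DFI1995.quad]; exact natDegree_quadratic ha
  have hF0 : F ≠ 0 := by
    rintro hF
    rw [hF, natDegree_zero] at hFdeg
    exact absurd hFdeg (by norm_num)
  have hcont : F.content ≠ 0 := mt content_eq_zero_iff.mp hF0
  set F₀ : ℤ[X] := F.primPart with hF₀def
  have hFF₀ : F = C F.content * F₀ := F.eq_C_content_mul_primPart
  have hF₀deg : F₀.natDegree = 2 := by rw [hF₀def, natDegree_primPart, hFdeg]
  have hF₀prim : F₀.IsPrimitive := isPrimitive_primPart F
  -- `F₀` is irreducible: over `ℚ`, `F` (hence the unit multiple `F₀`) has degree 2 and no root.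
  have hFeval : ∀ x : ℚ, (F.map (algebraMap ℤ ℚ)).eval x = a * x ^ 2 + 2 * b * x + c := by
    intro x
    simp only [hFdef, DFI1995.quad, Polynomial.map_add, Polynomial.map_mul, Polynomial.map_pow,
      map_X, Polynomial.map_C, eval_add, eval_mul, eval_C, eval_pow, eval_X]
    simp only [eq_intCast]
    push_cast
    ring
  have hFQdeg : (F.map (algebraMap ℤ ℚ)).natDegree = 2 := by
    rw [natDegree_map_eq_of_injective (algebraMap ℤ ℚ).injective_int, hFdeg]
  have hnoroot : ∀ x : ℚ, ¬ (F.map (algebraMap ℤ ℚ)).IsRoot x := by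
    intro x hx
    rw [IsRoot, hFeval] at hx
    have haQ : (a : ℚ) ≠ 0 := by exact_mod_cast ha
    have hdisc : ∀ s : ℚ, discrim (a : ℚ) (2 * b) c ≠ s ^ 2 := by
      intro s hs
      have hD' : ((0 : ℤ) : ℚ) < ((a * c - b ^ 2 : ℤ) : ℚ) := by exact_mod_cast hD
      push_cast at hD'
      unfold discrim at hs
      nlinarith [sq_nonneg s]
    exact quadratic_ne_zero_of_discrim_ne_sq hdisc x (by linear_combination hx)
  have hirrFQ : Irreducible (F.map (algebraMap ℤ ℚ)) :=
    irreducible_of_degree_le_three_of_not_isRoot (by rw [hFQdeg]; decide) hnoroot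
  have hirrF₀Q : Irreducible (F₀.map (algebraMap ℤ ℚ)) := by
    have hmap : F.map (algebraMap ℤ ℚ) =
        C (algebraMap ℤ ℚ F.content) * F₀.map (algebraMap ℤ ℚ) := by
      conv_lhs => rw [hFF₀]
      rw [Polynomial.map_mul, map_C]
    rw [hmap] at hirrFQ
    exact (irreducible_isUnit_mul (isUnit_C.mpr (IsUnit.mk0 _
      ((map_ne_zero_iff _ (algebraMap ℤ ℚ).injective_int).mpr hcont)))).1 hirrFQ
  have hirrF₀ : Irreducible F₀ :=
    (IsPrimitive.irreducible_iff_irreducible_map_fraction_map hF₀prim).2 hirrF₀Q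
  -- Hooley's Lemma 4 for `F₀`
  obtain ⟨C₀, hC₀, hL4⟩ :=
    exists_polyRootCountMod_le_mul_pow_card_primeFactors hirrF₀ (by rw [hF₀deg]; norm_num)
  set g : ℕ := F.content.natAbs with hgdef
  have hg0 : g ≠ 0 := Int.natAbs_ne_zero.mpr hcont
  refine ⟨(g : ℝ) * C₀, by exact_mod_cast Nat.one_le_iff_ne_zero.mpr (Nat.mul_ne_zero hg0 (by omega)),
    fun h n hn => ?_⟩
  -- roots of `F` mod `n` are roots of `F₀` mod `n₁ = n/(n,g)`, an `n₁`-periodic condition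
  have hgc : (g : ℤ) = F.content := by
    rw [hgdef, Int.natCast_natAbs, Int.abs_eq_normalize, normalize_content]
  set d : ℕ := Nat.gcd n g with hddef
  have hd0 : 0 < d := Nat.gcd_pos_of_pos_left _ (by omega)
  set n₁ : ℕ := n / d with hn₁def
  have hdn₁ : d * n₁ = n := Nat.mul_div_cancel' (Nat.gcd_dvd_left n g)
  have hdle : d ≤ g := Nat.gcd_le_right (m := n) (Nat.pos_of_ne_zero hg0)
  have hn0 : n ≠ 0 := by omega
  have hn₁0 : n₁ ≠ 0 := by
    intro h0; rw [h0, mul_zero] at hdn₁; omega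
  have hn₁dvd : n₁ ∣ n := ⟨d, by rw [mul_comm]; exact hdn₁.symm⟩
  -- step 1: `|ρ_h(n)| ≤ ρ_F(n) = #{ν < n : n ∣ F(ν)}`
  have h1 := norm_polyRootWeylSum_le F n h
  rw [← card_filter_dvd_eval_eq_polyRootCountMod] at h1
  -- step 2: `#{ν < n : n ∣ F(ν)} ≤ #{ν < n : n₁ ∣ F₀(ν)} = d ρ_{F₀}(n₁)`
  have h2 : ((Finset.range n).filter (fun ν : ℕ => (n : ℤ) ∣ F.eval (ν : ℤ))).card ≤
      ((Finset.range n).filter (fun ν : ℕ => (n₁ : ℤ) ∣ F₀.eval (ν : ℤ))).card := by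
    refine Finset.card_le_card fun ν hν => ?_
    rw [Finset.mem_filter] at hν ⊢
    refine ⟨hν.1, ?_⟩
    have hev : F.eval (ν : ℤ) = (g : ℤ) * F₀.eval (ν : ℤ) := by
      conv_lhs => rw [hFF₀]
      rw [eval_mul, eval_C, hgc]
    have := hν.2
    rw [hev] at this
    exact div_gcd_dvd_of_dvd_mul hg0 this
  have h3 : ((Finset.range n).filter (fun ν : ℕ => (n₁ : ℤ) ∣ F₀.eval (ν : ℤ))).card =
      d * polyRootCountMod ![F₀] n₁ := by
    rw [← card_filter_dvd_eval_eq_polyRootCountMod, ← card_filter_range_mul_dvd_eval, hdn₁]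
  -- step 3: Hooley's Lemma 4 and `2^{ω(n₁)} ≤ 2^{ω(n)} ≤ τ(n)`
  have h4 : polyRootCountMod ![F₀] n₁ ≤ C₀ * 2 ^ n.primeFactors.card := by
    refine (hL4 n₁).trans ?_
    rw [hF₀deg]
    exact Nat.mul_le_mul_left _ (Nat.pow_le_pow_right (by norm_num)
      (Finset.card_le_card (Nat.primeFactors_mono hn₁dvd hn0)))
  have h5 := GoldbachSeries.two_pow_card_primeFactors_le_card_divisors hn0
  -- assemble (in `ℝ`)
  have hmain : (((Finset.range n).filter (fun ν : ℕ => (n : ℤ) ∣ F.eval (ν : ℤ))).card : ℝ) ≤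
      (g * C₀ : ℕ) * (Nat.divisors n).card := by
    have : ((Finset.range n).filter (fun ν : ℕ => (n : ℤ) ∣ F.eval (ν : ℤ))).card ≤
        g * C₀ * (Nat.divisors n).card := by
      calc ((Finset.range n).filter (fun ν : ℕ => (n : ℤ) ∣ F.eval (ν : ℤ))).card
          ≤ d * polyRootCountMod ![F₀] n₁ := h2.trans h3.le
        _ ≤ g * (C₀ * 2 ^ n.primeFactors.card) := Nat.mul_le_mul hdle h4
        _ ≤ g * (C₀ * (Nat.divisors n).card) :=
            Nat.mul_le_mul_left _ (Nat.mul_le_mul_left _ h5)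
        _ = g * C₀ * (Nat.divisors n).card := by ring
    exact_mod_cast this
  calc ‖polyRootWeylSum F n h‖
      ≤ (((Finset.range n).filter (fun ν : ℕ => (n : ℤ) ∣ F.eval (ν : ℤ))).card : ℝ) := h1
    _ ≤ (g * C₀ : ℕ) * (Nat.divisors n).card := hmain
    _ = (g : ℝ) * C₀ * (Nat.divisors n).card := by push_cast; ring

/-! ### The hypotheses (34), (35) for `c_n = ρ_h(n)` (§7 of the paper) -/

namespace DFI1995

/-- The sequence `n ↦ ρ_h(n)`. [cite: DukeFriedlanderIwaniec1995, (4)] -/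
noncomputable def rhoSeq (f : ℤ[X]) (h : ℤ) : ℕ → ℂ := fun n => polyRootWeylSum f n h

/-- Unfolding `rhoSeq`. [folklore] -/
@[simp] theorem rhoSeq_apply (f : ℤ[X]) (h : ℤ) (n : ℕ) : rhoSeq f h n = polyRootWeylSum f n h :=
  rfl

/-- **Hypothesis (34) for `c_n = ρ_h(n)` at level `D = x^{1/2−ε}`**: for some `x₁, A`, for all
`x ≥ x₁` and all coefficients `|λ_d| ≤ 1`, `|R(D)| ≤ A x (log x)^{−2}`.
[cite: DukeFriedlanderIwaniec1995, §7 p. 438 and (34)] -/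
def Hyp34 (f : ℤ[X]) (h : ℤ) (ε : ℝ) : Prop :=
  ∃ x₁ A : ℝ, ∀ x : ℝ, x₁ ≤ x → ∀ lam : ℕ → ℂ, (∀ d : ℕ, ‖lam d‖ ≤ 1) →
    ‖sieveR₁ (rhoSeq f h) lam x (x ^ (1 / 2 - ε))‖ ≤ A * x / Real.log x ^ 2

/-- **Hypothesis (35) for `c_n = ρ_h(n)` with `y = x^{1/3−ε}`, `w = x^{(log log x)^{−3}}`**: for
some `x₁, A`, for all `x ≥ x₁` and all `|α_m| ≤ ω(m)`, `|β_n| ≤ 1` supported on primes,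
`|R(w, y)| ≤ A x (log x)^{−10}`. [cite: DukeFriedlanderIwaniec1995, §7 p. 438 and (35)] -/
def Hyp35 (f : ℤ[X]) (h : ℤ) (ε : ℝ) : Prop :=
  ∃ x₁ A : ℝ, ∀ x : ℝ, x₁ ≤ x → ∀ α β : ℕ → ℂ,
    (∀ m : ℕ, ‖α m‖ ≤ ArithmeticFunction.cardDistinctFactors m) →
    (∀ n : ℕ, ‖β n‖ ≤ 1) → (∀ n : ℕ, ¬ n.Prime → β n = 0) →
    ‖sieveR₂ (rhoSeq f h) α β x (x ^ ((Real.log (Real.log x))⁻¹ ^ 3)) (x ^ (1 / 3 - ε))‖ ≤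
      A * x / Real.log x ^ 10

end DFI1995

/-! ### The assembly (§7): Theorem 5 ⇒ `∑_{p ≤ x} ρ_h(p) = o(π(x))` -/

/-- **The positive-frequency case**: from Theorem 5, (34) and (35), for `f = aX² + 2bX + c` with
`ac − b² > 0` and `h ≥ 1`, `∑_{p ≤ P} ρ_h(p) = o(π(P))`.  (Theorem 5 is applied, for each
`0 < ε ≤ 1/12`, to `c_n = ρ_h(n)/C_f` where `|ρ_h(n)| ≤ C_f τ(n)`; it gives
`|∑_{p ≤ x} ρ_h(p)| ≤ C_f C ε π(x)` for `x ≥ x₀(ε)`, and `ε → 0`.)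
[cite: DukeFriedlanderIwaniec1995, §7 p. 438] -/
theorem DFI1995.isLittleO_sum_primesLE_of_theorem5 (H5 : dukeFriedlanderIwaniec1995_theorem5)
    {a b c : ℤ} (hD : 0 < a * c - b ^ 2) {h : ℕ}
    (H34 : ∀ ε : ℝ, 0 < ε → ε ≤ 1 / 12 → DFI1995.Hyp34 (DFI1995.quad a b c) h ε)
    (H35 : ∀ ε : ℝ, 0 < ε → ε ≤ 1 / 12 → DFI1995.Hyp35 (DFI1995.quad a b c) h ε) :
    (fun P : ℕ => ∑ p ∈ Nat.primesLE P, polyRootWeylSum (DFI1995.quad a b c) p h) =o[atTop]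
      fun P : ℕ => (Nat.primeCounting P : ℝ) := by
  obtain ⟨Cρ, hCρ, hρ⟩ := exists_norm_polyRootWeylSum_quad_le hD
  obtain ⟨C, HC⟩ := H5
  set f := DFI1995.quad a b c with hf
  -- the scaled sequence
  set cs : ℕ → ℂ := fun n => (Cρ : ℂ)⁻¹ * DFI1995.rhoSeq f h n with hcs
  have hCρ0 : (0 : ℝ) < Cρ := by linarith
  have hcs_le : ∀ n : ℕ, 1 ≤ n → ‖cs n‖ ≤ (Nat.divisors n).card := by
    intro n hn
    rw [hcs]
    simp only [DFI1995.rhoSeq_apply, norm_mul, norm_inv, Complex.norm_real, Real.norm_eq_abs,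
      abs_of_pos hCρ0]
    rw [inv_mul_le_iff₀ hCρ0]
    exact hρ h n hn
  rw [Asymptotics.isLittleO_iff]
  intro δ hδ
  -- choose `ε`
  set C' : ℝ := max C 1 with hC'
  have hC'0 : 0 < C' := lt_max_of_lt_right one_pos
  set ε : ℝ := min (1 / 12) (δ / (Cρ * C')) with hε
  have hε0 : 0 < ε := lt_min (by norm_num) (div_pos hδ (mul_pos hCρ0 hC'0))
  have hε12 : ε ≤ 1 / 12 := min_le_left _ _
  -- the hypotheses of Theorem 5 for `cs`
  obtain ⟨x₁, A₁, h34⟩ := H34 ε hε0 hε12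
  obtain ⟨x₂, A₂, h35⟩ := H35 ε hε0 hε12
  have h34' : ∀ x : ℝ, max x₁ x₂ ≤ x → ∀ lam : ℕ → ℂ, (∀ d : ℕ, ‖lam d‖ ≤ 1) →
      ‖DFI1995.sieveR₁ cs lam x (x ^ (1 / 2 - ε))‖ ≤ Cρ⁻¹ * A₁ * x / Real.log x ^ 2 := by
    intro x hx lam hlam
    rw [hcs, DFI1995.sieveR₁_const_mul, norm_mul, norm_inv, Complex.norm_real,
      Real.norm_eq_abs, abs_of_pos hCρ0, mul_assoc, mul_div_assoc]
    exact mul_le_mul_of_nonneg_left (h34 x ((le_max_left _ _).trans hx) lam hlam)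
      (inv_nonneg.2 hCρ0.le)
  have h35' : ∀ x : ℝ, max x₁ x₂ ≤ x → ∀ α β : ℕ → ℂ,
      (∀ m : ℕ, ‖α m‖ ≤ ArithmeticFunction.cardDistinctFactors m) →
      (∀ n : ℕ, ‖β n‖ ≤ 1) → (∀ n : ℕ, ¬ n.Prime → β n = 0) →
      ‖DFI1995.sieveR₂ cs α β x (x ^ ((Real.log (Real.log x))⁻¹ ^ 3)) (x ^ (1 / 3 - ε))‖ ≤
        Cρ⁻¹ * A₂ * x / Real.log x ^ 10 := by
    intro x hx α β hα hβ hβp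
    rw [hcs, DFI1995.sieveR₂_const_mul, norm_mul, norm_inv, Complex.norm_real,
      Real.norm_eq_abs, abs_of_pos hCρ0, mul_assoc, mul_div_assoc]
    exact mul_le_mul_of_nonneg_left (h35 x ((le_max_right _ _).trans hx) α β hα hβ hβp)
      (inv_nonneg.2 hCρ0.le)
  obtain ⟨x₀, hx₀⟩ := HC ε hε0 hε12 cs hcs_le (max x₁ x₂) (Cρ⁻¹ * A₁) (Cρ⁻¹ * A₂) h34' h35'
  -- conclusion for `P ≥ x₀`
  filter_upwards [eventually_ge_atTop ⌈x₀⌉₊] with P hP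
  have hPx : x₀ ≤ (P : ℝ) := (Nat.le_ceil x₀).trans (by exact_mod_cast hP)
  have hmain := hx₀ (P : ℝ) hPx
  rw [Nat.floor_natCast] at hmain
  -- unscale
  have hsum : ∑ p ∈ Nat.primesLE P, cs p = (Cρ : ℂ)⁻¹ * ∑ p ∈ Nat.primesLE P, polyRootWeylSum f p h := by
    rw [hcs, Finset.mul_sum]
    rfl
  rw [hsum, norm_mul, norm_inv, Complex.norm_real, Real.norm_eq_abs, abs_of_pos hCρ0,
    inv_mul_le_iff₀ hCρ0] at hmain
  rw [Real.norm_natCast]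
  refine hmain.trans ?_
  have hπ : (0 : ℝ) ≤ Nat.primeCounting P := Nat.cast_nonneg _
  have hεle : ε ≤ δ / (Cρ * C') := min_le_right _ _
  have hCC' : C ≤ C' := le_max_left _ _
  calc Cρ * (C * ε * (Nat.primeCounting P : ℝ)) ≤ Cρ * (C' * ε * Nat.primeCounting P) := by
        gcongr
    _ ≤ Cρ * (C' * (δ / (Cρ * C')) * Nat.primeCounting P) := by gcongr
    _ = δ * Nat.primeCounting P := by field_simp

namespace DFI1995

/-! ### Partial sums of `ρ_h(dm)` and the dyadic decomposition -/

/-- `S_d(t) = ∑_{1 ≤ m ≤ t} ρ_h(dm)`. [folklore] -/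
noncomputable def partialSum (f : ℤ[X]) (h : ℤ) (d : ℕ) (t : ℝ) : ℂ :=
  ∑ m ∈ Icc 1 ⌊t⌋₊, polyRootWeylSum f (d * m) h

/-- `L_d(M) = S_d(2M) − S_d(M)` for `M ≥ 0`. [folklore] -/
theorem linearForm_eq_partialSum_sub (f : ℤ[X]) (h : ℤ) (d : ℕ) {M : ℝ} (hM : 0 ≤ M) :
    linearForm f h d M = partialSum f h d (2 * M) - partialSum f h d M := by
  have hsplit := Finset.sum_filter_add_sum_filter_not (Icc 1 ⌊2 * M⌋₊) (fun m : ℕ => M < (m : ℝ))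
    (fun m : ℕ => polyRootWeylSum f (d * m) h)
  have hnot : (Icc 1 ⌊2 * M⌋₊).filter (fun m : ℕ => ¬ M < (m : ℝ)) = Icc 1 ⌊M⌋₊ := by
    ext m
    simp only [Finset.mem_filter, Finset.mem_Icc, not_lt]
    constructor
    · rintro ⟨⟨h1, -⟩, h2⟩
      exact ⟨h1, Nat.le_floor h2⟩
    · rintro ⟨h1, h2⟩
      have hmM : (m : ℝ) ≤ M := by
        have := Nat.floor_le hM
        exact le_trans (by exact_mod_cast h2) this
      refine ⟨⟨h1, ?_⟩, hmM⟩
      exact Nat.le_floor (by linarith)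
  rw [hnot] at hsplit
  unfold linearForm partialSum
  rw [← hsplit]
  ring

/-- **Dyadic decomposition**: `S_d(X) = S_d(X/2^J) + ∑_{j<J} L_d(X/2^{j+1})`. [folklore] -/
theorem partialSum_eq_dyadic (f : ℤ[X]) (h : ℤ) (d : ℕ) {X : ℝ} (hX : 0 ≤ X) (J : ℕ) :
    partialSum f h d X =
      partialSum f h d (X / 2 ^ J) + ∑ j ∈ Finset.range J, linearForm f h d (X / 2 ^ (j + 1)) := by
  induction J with
  | zero => simp
  | succ J ih =>
    rw [Finset.sum_range_succ, ih, linearForm_eq_partialSum_sub f h d (by positivity)]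
    have : 2 * (X / 2 ^ (J + 1)) = X / 2 ^ J := by
      rw [pow_succ]; field_simp
    rw [this]
    ring

/-! ### The fibre sums of `R(w, y)` and their dyadic blocks -/

/-- `T_S(t) = ∑_{n ∈ S} β_n ∑_{m ≤ t, (m,n)=1} α_m ρ_h(mn)`: the part of `R(w, y)` with `n` in the
fibre `S` and the cutoff `m ≤ t`. [folklore] -/
noncomputable def fiberSum (f : ℤ[X]) (h : ℤ) (α β : ℕ → ℂ) (S : Finset ℕ) (t : ℝ) : ℂ :=
  ∑ n ∈ S, β n * ∑ m ∈ (Icc 1 ⌊t⌋₊).filter (fun m : ℕ => Nat.Coprime m n),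
    α m * polyRootWeylSum f (m * n) h

/-- The coefficients of a dyadic block: `α` restricted to `M < m ≤ 2M`. [folklore] -/
noncomputable def blockAlpha (α : ℕ → ℂ) (M : ℝ) : ℕ → ℂ :=
  fun m => if M < (m : ℝ) ∧ (m : ℝ) ≤ 2 * M then α m else 0

/-- The coefficients of a fibre: `β` restricted to `S`. [folklore] -/
noncomputable def fiberBeta (β : ℕ → ℂ) (S : Finset ℕ) : ℕ → ℂ :=
  fun n => if n ∈ S then β n else 0

/-- **A dyadic block of a fibre sum is a bilinear form `B(M, N')`**:
`T_S(2M) − T_S(M) = B(M, N')(α|_{(M,2M]}, β|_S)` for `S ⊆ [1, 2N']`. [folklore] -/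
theorem fiberSum_two_mul_sub (f : ℤ[X]) (h : ℤ) (α β : ℕ → ℂ) {S : Finset ℕ} {N' M : ℝ}
    (hS : S ⊆ Icc 1 ⌊2 * N'⌋₊) (hM : 0 ≤ M) :
    fiberSum f h α β S (2 * M) - fiberSum f h α β S M =
      bilinearForm f h (blockAlpha α M) (fiberBeta β S) M N' := by
  -- the right-hand side, inner sum restricted to `S`
  have hR : bilinearForm f h (blockAlpha α M) (fiberBeta β S) M N' =
      ∑ m ∈ Icc 1 ⌊2 * M⌋₊, ∑ n ∈ S.filter (fun n : ℕ => Nat.Coprime m n),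
        blockAlpha α M m * β n * polyRootWeylSum f (m * n) h := by
    unfold bilinearForm
    refine Finset.sum_congr rfl fun m _ => ?_
    have hfilt : S.filter (fun n : ℕ => Nat.Coprime m n) =
        ((Icc 1 ⌊2 * N'⌋₊).filter (fun n : ℕ => Nat.Coprime m n)).filter (fun n => n ∈ S) := by
      ext n
      simp only [Finset.mem_filter]
      constructor
      · rintro ⟨h1, h2⟩; exact ⟨⟨hS h1, h2⟩, h1⟩
      · rintro ⟨⟨-, h2⟩, h3⟩; exact ⟨h3, h2⟩
    conv_rhs => rw [hfilt, Finset.sum_filter]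
    refine Finset.sum_congr rfl fun n _ => ?_
    unfold fiberBeta
    split_ifs <;> simp
  -- swap the sums
  have hswap : ∑ m ∈ Icc 1 ⌊2 * M⌋₊, ∑ n ∈ S.filter (fun n : ℕ => Nat.Coprime m n),
        blockAlpha α M m * β n * polyRootWeylSum f (m * n) h =
      ∑ n ∈ S, ∑ m ∈ (Icc 1 ⌊2 * M⌋₊).filter (fun m : ℕ => Nat.Coprime m n),
        blockAlpha α M m * β n * polyRootWeylSum f (m * n) h := by
    refine Finset.sum_comm' fun m n => ?_
    simp only [Finset.mem_filter]
    tauto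
  -- each fibre term
  have hblock : ∀ n ∈ S, ∑ m ∈ (Icc 1 ⌊2 * M⌋₊).filter (fun m : ℕ => Nat.Coprime m n),
        blockAlpha α M m * β n * polyRootWeylSum f (m * n) h =
      β n * ∑ m ∈ ((Icc 1 ⌊2 * M⌋₊).filter (fun m : ℕ => Nat.Coprime m n)).filter
        (fun m : ℕ => M < (m : ℝ)), α m * polyRootWeylSum f (m * n) h := by
    intro n _
    rw [Finset.sum_filter (fun m : ℕ => M < (m : ℝ)), Finset.mul_sum]
    refine Finset.sum_congr rfl fun m hm => ?_
    have hm2 : (m : ℝ) ≤ 2 * M := by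
      have h1 := (Finset.mem_Icc.1 (Finset.mem_filter.1 hm).1).2
      exact le_trans (by exact_mod_cast h1) (Nat.floor_le (by linarith))
    unfold blockAlpha
    by_cases hMm : M < (m : ℝ)
    · rw [if_pos ⟨hMm, hm2⟩, if_pos hMm]; ring
    · rw [if_neg (fun h => hMm h.1), if_neg hMm]; ring
  -- the left-hand side
  have hL : ∀ n ∈ S, (∑ m ∈ (Icc 1 ⌊2 * M⌋₊).filter (fun m : ℕ => Nat.Coprime m n),
        α m * polyRootWeylSum f (m * n) h) -
      (∑ m ∈ (Icc 1 ⌊M⌋₊).filter (fun m : ℕ => Nat.Coprime m n),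
        α m * polyRootWeylSum f (m * n) h) =
      ∑ m ∈ ((Icc 1 ⌊2 * M⌋₊).filter (fun m : ℕ => Nat.Coprime m n)).filter
        (fun m : ℕ => M < (m : ℝ)), α m * polyRootWeylSum f (m * n) h := by
    intro n _
    have hsplit := Finset.sum_filter_add_sum_filter_not
      ((Icc 1 ⌊2 * M⌋₊).filter (fun m : ℕ => Nat.Coprime m n)) (fun m : ℕ => M < (m : ℝ))
      (fun m : ℕ => α m * polyRootWeylSum f (m * n) h)
    have hnot : ((Icc 1 ⌊2 * M⌋₊).filter (fun m : ℕ => Nat.Coprime m n)).filter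
        (fun m : ℕ => ¬ M < (m : ℝ)) = (Icc 1 ⌊M⌋₊).filter (fun m : ℕ => Nat.Coprime m n) := by
      ext m
      simp only [Finset.mem_filter, Finset.mem_Icc, not_lt]
      constructor
      · rintro ⟨⟨⟨h1, -⟩, h2⟩, h3⟩
        exact ⟨⟨h1, Nat.le_floor h3⟩, h2⟩
      · rintro ⟨⟨h1, h2⟩, h3⟩
        have hmM : (m : ℝ) ≤ M := le_trans (by exact_mod_cast h2) (Nat.floor_le hM)
        exact ⟨⟨⟨h1, Nat.le_floor (by linarith)⟩, h3⟩, hmM⟩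
    rw [hnot] at hsplit
    rw [← hsplit]; ring
  rw [hR, hswap]
  unfold fiberSum
  rw [← Finset.sum_sub_distrib]
  refine Finset.sum_congr rfl fun n hn => ?_
  rw [hblock n hn, ← mul_sub, hL n hn]

/-- **Dyadic decomposition of a fibre sum**:
`T_S(X) = T_S(X/2^J) + ∑_{j<J} (T_S(X/2^j) − T_S(X/2^{j+1}))`. [folklore] -/
theorem fiberSum_eq_dyadic (f : ℤ[X]) (h : ℤ) (α β : ℕ → ℂ) (S : Finset ℕ) (X : ℝ) (J : ℕ) :
    fiberSum f h α β S X = fiberSum f h α β S (X / 2 ^ J) +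
      ∑ j ∈ Finset.range J, (fiberSum f h α β S (2 * (X / 2 ^ (j + 1))) -
        fiberSum f h α β S (X / 2 ^ (j + 1))) := by
  induction J with
  | zero => simp
  | succ J ih =>
    rw [Finset.sum_range_succ, ih]
    have : 2 * (X / 2 ^ (J + 1)) = X / 2 ^ J := by rw [pow_succ]; field_simp
    rw [this]; ring

/-- The block coefficients are supported in `(M, 2M]`. [folklore] -/
theorem blockAlpha_ne_zero {α : ℕ → ℂ} {M : ℝ} {m : ℕ} (hm : blockAlpha α M m ≠ 0) :
    M < (m : ℝ) ∧ (m : ℝ) ≤ 2 * M := by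
  unfold blockAlpha at hm
  by_contra hc
  exact hm (if_neg hc)

/-- `|blockAlpha α M m| ≤ |α m|`. [folklore] -/
theorem norm_blockAlpha_le (α : ℕ → ℂ) (M : ℝ) (m : ℕ) : ‖blockAlpha α M m‖ ≤ ‖α m‖ := by
  unfold blockAlpha
  split_ifs <;> simp

/-- The fibre coefficients are supported in `S`. [folklore] -/
theorem fiberBeta_ne_zero {β : ℕ → ℂ} {S : Finset ℕ} {n : ℕ} (hn : fiberBeta β S n ≠ 0) :
    n ∈ S ∧ β n ≠ 0 := by
  unfold fiberBeta at hn
  by_cases h : n ∈ S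
  · rw [if_pos h] at hn; exact ⟨h, hn⟩
  · rw [if_neg h] at hn; exact absurd rfl hn

/-- A fibre sum with cutoff below `1` vanishes. [folklore] -/
theorem fiberSum_eq_zero_of_lt_one (f : ℤ[X]) (h : ℤ) (α β : ℕ → ℂ) (S : Finset ℕ) {t : ℝ}
    (ht : t < 1) : fiberSum f h α β S t = 0 := by
  unfold fiberSum
  have h0 : ⌊t⌋₊ = 0 := Nat.floor_eq_zero.2 ht
  rw [h0]
  simp

end DFI1995

end Literature.NumberTheory.Sieve
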